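import Summits.Ventures.YMGap.RobustBall.ScreenedStabilityStar
import Summits.Ventures.YMGap.RobustBall.BallClosureZdG
import Summits.Ventures.YMGap.RobustBall.TruncationConvergenceS
import HarnessLib

/-!
# Venture YMGap, track ROBUST-BALL (Y2) — THROUGH THE STAR DOOR: expectations along the truncated lines `W + s·𝟙_{T_n} V` converge to those
# along `W + s·V`, UNIFORMLY in `|s| ≤ s₀` (tier-1 gauge-invariant ball; the star twin of `TruncationConvergenceS`)

HONEST FRAMING. WHAT THIS IS: a venture file (cell `pub-ymgap`, track Y2 ROBUST-BALL, seat rb-p1, theorems only).  Setting: `(W, supp)` and a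
direction `(V, suppV)` in ds-2's gauge-invariant tier-1 ball (`MemBallZdG`), a uniform star window bound (locality radius `D ≥ max R R_V + 2`,
received sum `0 ≤ ρ < 1`) for EVERY truncated line `W + s·𝟙_{T_n} V`, `|s| ≤ s₀` (supplied on the cell's balls by `BallClosureZdG.add_smul_indicator` +
ds-2's `starWindowBoundZdR_of_memBallZdG`), oscillation witnesses of `V` with window loads `≤ B_V` on every vertex star, and finite term sets `T_n`
eventually containing every active term of `V`.
* `windowLoad_rem_le` / `windowLoad_rem_eq_zero` — the window loads of the remainder `s·𝟙_{T_nᶜ} V` are `≤ s₀·B_V` everywhere and VANISH on a star once `T_n` contains the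
  star's active listed terms;
* ★ `tendstoUniformlyOn_integral_truncation_star` — for every Lipschitz local observable `f` and all DLR states `ν_n(s)` of the truncated lines and `ν(s)`
  of the full lines: `s ↦ ∫ f dν_n(s)` → `s ↦ ∫ f dν(s)` UNIFORMLY on `[-s₀, s₀]` (screened stability through the star door, `ScreenedStabilityStar`: the far
  level costs `ρ^{⌊(r−1)/(D+2)⌋}`, the near level is eventually ZERO because finitely many stars list finitely many terms).
WHAT THIS IS NOT: the derivative statement (next file); one-sided comparison constants; lattice strong coupling only; nothing about the continuum
limit or a Clay-sense mass gap.
-/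

noncomputable section

open MeasureTheory Function Finset Real Filter Topology
open scoped NNReal
open Literature.Probability.LatticeModels
open Literature.Probability.LatticeModels.DobrushinMetric
open Literature.MathematicalPhysics.QuantumLattice
open Literature.MathematicalPhysics.QuantumFieldTheory hiding ZdEdge
open Summit.Ventures.YMGap.DSWindowZd

namespace Summit.Ventures.YMGap.RobustBall

variable {d N : ℕ}

/-! ### Window loads of the remainder `s·𝟙_{Tᶜ} V` -/

section Loads

variable {V : Potential (ZdEdge d) (SUN N)} {suppV : Finset (ZdEdge d) → Finset (Finset (ZdEdge d))}
  {oscV : Finset (ZdEdge d) → ZdEdge d → ℝ}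

open Classical in
/-- The switched-off, truncated, scaled witnesses `|s|·[A ∉ T]·[V A ≠ 0]·oscV A` are oscillation witnesses of the remainder `s·𝟙_{Tᶜ} V`. -/
theorem isOscBound_rem (hoscV : ∀ X, Dobrushin.IsOscBound (V X) (oscV X)) (T : Finset (Finset (ZdEdge d))) (s : ℝ)
    (A : Finset (ZdEdge d)) :
    Dobrushin.IsOscBound ((s • ((↑T : Set (Finset (ZdEdge d)))ᶜ).indicator V) A)
      (fun x => if A ∈ T ∨ V A = 0 then 0 else |s| * oscV A x) := by
  refine ⟨fun x => by
    by_cases h : A ∈ T ∨ V A = 0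
    · simp only [if_pos h]; exact le_rfl
    · simp only [if_neg h]; exact mul_nonneg (abs_nonneg s) ((hoscV A).nonneg x), fun x σ τ hστ => ?_⟩
  by_cases h : A ∈ T ∨ V A = 0
  · rw [if_pos h]
    have h0 : (s • ((↑T : Set (Finset (ZdEdge d)))ᶜ).indicator V) A = 0 := by
      rcases h with h | h
      · simp only [Pi.smul_apply, Set.indicator_of_notMem (show A ∉ ((↑T : Set _))ᶜ from fun hc => hc (Finset.mem_coe.2 h)), smul_zero]
      · simp only [Pi.smul_apply]
        rw [show ((↑T : Set (Finset (ZdEdge d)))ᶜ).indicator V A = 0 from by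
          by_cases hA : A ∈ ((↑T : Set (Finset (ZdEdge d))))ᶜ
          · rw [Set.indicator_of_mem hA, h]
          · rw [Set.indicator_of_notMem hA], smul_zero]
    rw [h0]; simp
  · rw [if_neg h]
    rw [not_or] at h
    have hA : A ∈ ((↑T : Set (Finset (ZdEdge d))))ᶜ := fun hc => h.1 (Finset.mem_coe.1 hc)
    simp only [Pi.smul_apply, Set.indicator_of_mem hA, smul_eq_mul]
    rw [← mul_sub, abs_mul]
    exact mul_le_mul_of_nonneg_left ((hoscV A).le x σ τ hστ) (abs_nonneg s)

open Classical in
/-- **Far level**: the remainder's window loads are `≤ |s|·(window load of V)`. -/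
theorem windowLoad_rem_le (hoscV : ∀ X, Dobrushin.IsOscBound (V X) (oscV X)) (T : Finset (Finset (ZdEdge d))) (s : ℝ)
    (P : Finset (ZdEdge d)) :
    windowLoad d suppV (fun A x => if A ∈ T ∨ V A = 0 then 0 else |s| * oscV A x) P ≤ |s| * windowLoad d suppV oscV P := by
  unfold windowLoad
  rw [Finset.mul_sum]
  refine Finset.sum_le_sum fun x _ => ?_
  rw [Finset.mul_sum]
  refine Finset.sum_le_sum fun A _ => ?_
  show (if A ∈ T ∨ V A = 0 then 0 else |s| * oscV A x) ≤ |s| * oscV A x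
  split_ifs
  · exact mul_nonneg (abs_nonneg s) ((hoscV A).nonneg x)
  · exact le_rfl

open Classical in
/-- **Near level**: once `T` contains every active term listed for the window `P`, the remainder's window load on `P` VANISHES. -/
theorem windowLoad_rem_eq_zero (T : Finset (Finset (ZdEdge d))) (s : ℝ) (P : Finset (ZdEdge d))
    (hT : ∀ A ∈ suppV P, V A ≠ 0 → A ∈ T) :
    windowLoad d suppV (fun A x => if A ∈ T ∨ V A = 0 then 0 else |s| * oscV A x) P = 0 := by
  unfold windowLoad
  refine Finset.sum_eq_zero fun x _ => Finset.sum_eq_zero fun A hA => ?_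
  show (if A ∈ T ∨ V A = 0 then 0 else |s| * oscV A x) = 0
  rw [if_pos]
  by_cases hV : V A = 0
  · exact Or.inr hV
  · exact Or.inl (hT A (Finset.mem_filter.1 hA).1 hV)

end Loads

/-! ### Uniform convergence along truncations through the star door -/

section Main

variable {W V : Potential (ZdEdge d) (SUN N)} {supp suppV : Finset (ZdEdge d) → Finset (Finset (ZdEdge d))}

/-- ★ **THROUGH THE STAR DOOR, EXPECTATIONS ALONG THE TRUNCATED LINES CONVERGE UNIFORMLY IN `|s| ≤ s₀`.**  `(W, supp) ∈ MemBallZdG ε₀ ε₁ R`,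
direction `(V, suppV) ∈ MemBallZdG ε₀V ε₁V R_V` with oscillation witnesses `oscV` of window load `≤ B_V` on every vertex star; a UNIFORM star
window bound (radius `D ≥ max R R_V + 2`, received sum `0 ≤ ρ < 1`) for every truncated line `W + s·𝟙_{T_n} V`, `|s| ≤ s₀`; term sets `T_n`
eventually containing every active term of `V`; `ν_n(s)`, `ν(s)` ANY DLR states of the truncated / full lines on `|s| ≤ s₀`.  Then for every bounded measurable
`f` local on `Δ` with a Frobenius-Lipschitz vector: `TendstoUniformlyOn (n ↦ s ↦ ∫ f dν_n(s)) (s ↦ ∫ f dν(s)) atTop [-s₀, s₀]`. -/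
theorem tendstoUniformlyOn_integral_truncation_star {β ε₀ ε₁ ε₀V ε₁V s₀ ρ BV : ℝ} {R RV D : ℕ}
    (hW : MemBallZdG ε₀ ε₁ R W supp) (hV : MemBallZdG ε₀V ε₁V RV V suppV)
    {oscV : Finset (ZdEdge d) → ZdEdge d → ℝ} (hoscV : ∀ X, Dobrushin.IsOscBound (V X) (oscV X))
    (hBV : ∀ c : ZdEdge d, windowLoad d suppV oscV (starWinZd c) ≤ BV) (hBV0 : 0 ≤ BV) (hs₀ : 0 ≤ s₀) (h₀V : 0 ≤ ε₀V)
    (h₁V : 0 ≤ ε₁V) (hD : max R RV + 2 ≤ D) (hρ0 : 0 ≤ ρ) (hρ1 : ρ < 1) {T : ℕ → Finset (Finset (ZdEdge d))}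
    (hwin : ∀ n s, |s| ≤ s₀ → StarWindowBoundZdR d N (perturbedYM (d := d) (fundamentalRep (Fin N)) (N * β)
      (W + s • (↑(T n) : Set (Finset (ZdEdge d))).indicator V) (fun Λ => supp Λ ∪ suppV Λ)) D ρ suFrobDist)
    (hT : ∀ A, V A ≠ 0 → ∀ᶠ n in atTop, A ∈ T n)
    {νn : ℕ → ℝ → Measure (LGConfig d (SUN N))}
    (hνn : ∀ n, ∀ s ∈ Set.Icc (-s₀) s₀, νn n s ∈ perturbedGibbsMeasures (d := d) (fundamentalRep (Fin N)) (N * β)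
      (W + s • (↑(T n) : Set (Finset (ZdEdge d))).indicator V) (fun Λ => supp Λ ∪ suppV Λ))
    {ν : ℝ → Measure (LGConfig d (SUN N))}
    (hν : ∀ s ∈ Set.Icc (-s₀) s₀, ν s ∈ perturbedGibbsMeasures (d := d) (fundamentalRep (Fin N)) (N * β) (W + s • V)
      (fun Λ => supp Λ ∪ suppV Λ))
    {f : LGConfig d (SUN N) → ℝ} (hfm : Measurable f) {Bf : ℝ} (hBf : ∀ σ, |f σ| ≤ Bf) {Δ : Finset (ZdEdge d)}
    (hfdep : DependsOn f (↑Δ : Set (ZdEdge d))) {δ : ZdEdge d → ℝ} (hδ : IsLipBound suFrobDist f δ) :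
    TendstoUniformlyOn (fun n s => ∫ σ, f σ ∂(νn n s)) (fun s => ∫ σ, f σ ∂(ν s)) atTop (Set.Icc (-s₀) s₀) := by
  classical
  haveI : SecondCountableTopology (Matrix (Fin N) (Fin N) ℂ) :=
    inferInstanceAs (SecondCountableTopology (Fin N → Fin N → ℂ))
  haveI : SecondCountableTopology (SUN N) := Topology.IsEmbedding.subtypeVal.secondCountableTopology
  rw [Metric.tendstoUniformlyOn_iff]
  intro ε hε
  -- constants
  have hδ0 : 0 ≤ ∑ y ∈ Δ, δ y := Finset.sum_nonneg fun y _ => hδ.nonneg y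
  set C : ℝ := 2 * Real.sqrt N / (1 - ρ) with hC
  have hC0 : 0 ≤ C := div_nonneg (by positivity) (by linarith)
  set B₁ : ℝ := s₀ * BV with hB₁
  have hB₁0 : 0 ≤ B₁ := mul_nonneg hs₀ hBV0
  -- the comparison at a fixed `n`, `s`, given the near-level exhaustion within radius `r`
  have step : ∀ (r B₀ : ℝ), 0 ≤ B₀ → ∀ n s, s ∈ Set.Icc (-s₀) s₀ →
      (∀ c : ZdEdge d, linkSetDist Δ c ≤ r → windowLoad d suppV (fun A x => if A ∈ T n ∨ V A = 0 then 0 else |s| * oscV A x) (starWinZd c) ≤ B₀) →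
      |(∫ σ, f σ ∂(ν s)) - ∫ σ, f σ ∂(νn n s)| ≤
        C * (min (Real.exp B₀ - 1) 2 + min (Real.exp B₁ - 1) 2 * ρ ^ ⌊max (r - 1) 0 / (D + 2 : ℕ)⌋₊) * ∑ y ∈ Δ, δ y := by
    intro r B₀ hB₀ n s hs hnear
    have hsabs : |s| ≤ s₀ := abs_le.2 ⟨hs.1, hs.2⟩
    -- the base `W + s·𝟙_{T n} V` and the remainder `s·𝟙_{(T n)ᶜ} V`
    set Tn : Set (Finset (ZdEdge d)) := (↑(T n) : Set (Finset (ZdEdge d))) with hTn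
    have hbase : MemBallZdG (ε₀ + s₀ * ε₀V) (ε₁ + s₀ * ε₁V) (max R RV) (W + s • Tn.indicator V) (fun Λ => supp Λ ∪ suppV Λ) :=
      hW.add_smul_indicator hV h₀V h₁V le_rfl le_rfl hsabs Tn
    have hrem : MemBallZdG (|s| * ε₀V) (|s| * ε₁V) RV (s • Tnᶜ.indicator V) suppV := (hV.indicator Tnᶜ).smul s
    have hremA : Potential.IsAdapted (s • Tnᶜ.indicator V) := fun X => ⟨hrem.dependsOn X, (hrem.continuous X).measurable⟩
    have hremb : ∀ X, ∃ C, ∀ U, |(s • Tnᶜ.indicator V) X U| ≤ C := fun X => exists_bound_of_continuous (hrem.continuous X)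
    -- the full line is base + remainder, with the same support family
    have hsum : W + s • Tn.indicator V + s • Tnᶜ.indicator V = W + s • V := by
      rw [add_assoc, ← smul_add, Set.indicator_self_add_compl]
    have hfam : (fun Λ => (supp Λ ∪ suppV Λ) ∪ suppV Λ) = fun Λ => supp Λ ∪ suppV Λ :=
      funext fun Λ => by rw [Finset.union_assoc, Finset.union_idempotent]
    have hν' : ν s ∈ perturbedGibbsMeasures (d := d) (fundamentalRep (Fin N)) (N * β)
        (W + s • Tn.indicator V + s • Tnᶜ.indicator V) (fun Λ => (supp Λ ∪ suppV Λ) ∪ suppV Λ) := by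
      rw [hsum, hfam]; exact hν s hs
    have hfar : ∀ c : ZdEdge d, windowLoad d suppV (fun A x => if A ∈ T n ∨ V A = 0 then 0 else |s| * oscV A x) (starWinZd c) ≤ B₁ := fun c =>
      (windowLoad_rem_le hoscV (T n) s _).trans (mul_le_mul hsabs (hBV c)
        (by unfold windowLoad; exact Finset.sum_nonneg fun x _ => Finset.sum_nonneg fun A _ => (hoscV A).nonneg x) hs₀)
    have key := abs_integral_sub_integral_le_of_perturbation_screened_star hbase.continuous hbase.dependsOn hbase.supportedBy hbase.range
      hD hρ0 hρ1 (hwin n s hsabs) hremA hremb hrem.supportedBy (fun A => isOscBound_rem hoscV (T n) s A) hB₀ hB₁0 hfar hnear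
      (hνn n s hs) hν' hfm hBf hfdep hδ
    rw [abs_sub_comm] at key
    exact key
  by_cases hΔ : Δ.Nonempty
  · -- far level: choose `m` with `C·2·ρ^m·Σδ < ε`, radius `r = (D+2)m + 1`
    obtain ⟨m, hm⟩ : ∃ m : ℕ, C * (min (Real.exp B₁ - 1) 2 * ρ ^ m) * ∑ y ∈ Δ, δ y < ε := by
      have ht : Tendsto (fun m : ℕ => C * (min (Real.exp B₁ - 1) 2 * ρ ^ m) * ∑ y ∈ Δ, δ y) atTop
          (𝓝 (C * (min (Real.exp B₁ - 1) 2 * 0) * ∑ y ∈ Δ, δ y)) :=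
        ((tendsto_const_nhds.mul (tendsto_pow_atTop_nhds_zero_of_lt_one hρ0 hρ1)).const_mul C).mul_const _
      rw [mul_zero, mul_zero, zero_mul] at ht
      exact (ht.eventually (gt_mem_nhds hε)).exists
    set r : ℝ := ((D + 2 : ℕ) : ℝ) * m + 1 with hr
    have hfloor : ⌊max (r - 1) 0 / (D + 2 : ℕ)⌋₊ = m := by
      have hD2 : (0 : ℝ) < ((D + 2 : ℕ) : ℝ) := by positivity
      have h1 : max (r - 1) 0 = ((D + 2 : ℕ) : ℝ) * m := by rw [hr, add_sub_cancel_right, max_eq_left (by positivity)]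
      rw [h1, mul_div_cancel_left₀ _ hD2.ne', Nat.floor_natCast]
    -- near level: finitely many stars within `r` of `Δ`, each listing finitely many terms; eventually all active ones are in `T n`
    have hfin := finite_near_links hΔ r
    have hnearT : ∀ᶠ n in atTop, ∀ c : ZdEdge d, linkSetDist Δ c ≤ r → ∀ A ∈ suppV (starWinZd c), V A ≠ 0 → A ∈ T n := by
      have key : ∀ᶠ n in atTop, ∀ c ∈ hfin.toFinset, ∀ A ∈ (suppV (starWinZd c)).filter (fun A => V A ≠ 0), A ∈ T n := by
        refine (hfin.toFinset.eventually_all).2 fun c _ => ((Finset.filter _ _).eventually_all).2 fun A hA => ?_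
        exact hT A (Finset.mem_filter.1 hA).2
      exact key.mono fun n hn c hc A hA hVA => hn c (hfin.mem_toFinset.2 hc) A (Finset.mem_filter.2 ⟨hA, hVA⟩)
    refine hnearT.mono fun n hn s hs => ?_
    rw [Real.dist_eq]
    have hnear : ∀ c : ZdEdge d, linkSetDist Δ c ≤ r → windowLoad d suppV (fun A x => if A ∈ T n ∨ V A = 0 then 0 else |s| * oscV A x) (starWinZd c) ≤ 0 :=
      fun c hc => (windowLoad_rem_eq_zero (T n) s _ (hn c hc)).le
    refine lt_of_le_of_lt (step r 0 le_rfl n s hs hnear) ?_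
    rw [Real.exp_zero, sub_self, min_eq_left (by norm_num : (0 : ℝ) ≤ 2), zero_add, hfloor]
    exact hm
  · -- `Δ = ∅`: the bound of `step` (with `B₀ = B₁`, `r = 0`) is `… · Σ_{∅} δ = 0`
    have hΔ0 : Δ = ∅ := Finset.not_nonempty_iff_eq_empty.1 hΔ
    refine Filter.Eventually.of_forall fun n s hs => ?_
    rw [Real.dist_eq]
    have hnear : ∀ c : ZdEdge d, linkSetDist Δ c ≤ 0 → windowLoad d suppV (fun A x => if A ∈ T n ∨ V A = 0 then 0 else |s| * oscV A x) (starWinZd c) ≤ B₁ := by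
      intro c _
      have hsabs : |s| ≤ s₀ := abs_le.2 ⟨hs.1, hs.2⟩
      exact (windowLoad_rem_le hoscV (T n) s _).trans (mul_le_mul hsabs (hBV c)
        (by unfold windowLoad; exact Finset.sum_nonneg fun x _ => Finset.sum_nonneg fun A _ => (hoscV A).nonneg x) hs₀)
    refine lt_of_le_of_lt (step 0 B₁ hB₁0 n s hs hnear) ?_
    rw [hΔ0, Finset.sum_empty, mul_zero]
    exact hε

end Main

end Summit.Ventures.YMGap.RobustBall

end
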